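import Summits.ValiantsHypothesis.ValiantsHypothesis.Theorems.BarrierLeverPriorityPeelingCertificate

/-!
# Route BarrierLever — priority peeling for TT: derived rules and a worked kernel certificate

Helper file (`--supports stmt-ValiantsHypothesis-19152`; cell valiant-natproofs, rung V4, 𝒟-side;
prover gen 7; memo `HOME/prover/gen7/PP-MEMO-g7.md` §3/§5). Closes NO item.

* `PPDerivable.of_isEmpty`: a configuration with NO rows (any rank) is derivable (vacuous pair
  moves down to rank `0`); needed for the children `child₁ = ∅` of a pair move along a coordinate
  that is constant on the rows (the dimension-reduction case).
* `squareClaw_derivable`: the R1/R2-IRREDUCIBLE «parity-locked» layout square × claw of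
  TNS-calculus-g8 §6.3 (h = 3, r = 4: `u = (∅, {0}, {1}, {0,1})`, `w = (∅, {0}, {1}, {2})`) has a
  priority-peeling derivation (two pair moves, the first ACROSS column pairs; memo §3), hence
  (`squareClaw_good`) its TT layout matrix is nonsingular for some `H` — the first member of item
  19616's irreducible core settled in the kernel, and an end-to-end test of the certificate format.

WHAT THIS IS NOT: nothing on derivations for all layouts, on crux stmt-ValiantsHypothesis-14610, or
on `VP` versus `VNP`.
-/

-- layout Summits/ValiantsHypothesis/ValiantsHypothesis forces the duplicated namespace component
set_option linter.dupNamespace false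

namespace Summit.ValiantsHypothesis.ValiantsHypothesis.Theorems.BarrierLever.PriorityPeeling

open Finset Matrix

/-! ## 1. Empty configurations -/

/-- A configuration with no rows is derivable (given two distinct row literals to peel along). -/
theorem PPDerivable.of_isEmpty {nr nc : ℕ} (ℓ₀ ℓ₁ : Fin nr) (hℓ : ℓ₀ ≠ ℓ₁) :
    ∀ (e : ℕ) (ι : Type) [Fintype ι] [DecidableEq ι] [IsEmpty ι]
      (R : ι → Fin e → Fin nr) (C : ι → Fin e → Fin nc), PPDerivable nr nc ι e R C := by
  intro e
  induction e with
  | zero =>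
    intro ι _ _ _ R C
    exact PPDerivable.rank_zero R C
  | succ d ih =>
    intro ι _ _ _ R C
    refine PPDerivable.pair R C ℓ₀ ℓ₁ hℓ (fun _ => false) (fun _ => 0) (fun i => isEmptyElim i)
      (fun i => isEmptyElim i) ∅ ∅ (fun _ => 0) (fun _ => false) (fun _ => 0)
      (fun j => isEmptyElim j) (fun j => isEmptyElim j) (Equiv.refl ι) (fun i => isEmptyElim i)
      ?_ ?_
    · exact ih _ _ _
    · exact ih _ _ _

/-! ## 2. A worked kernel certificate: square × claw -/

/-- **square × claw is PP-derivable** (h = 3, r = 4; `u = (∅,{0},{1},{0,1})`, `w = (∅,{0},{1},{2})`;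
R1/R2-irreducible, TNS-calculus-g8 §6.3). Move 1 peels coordinate `2` of the rows (constant: all
rows carry the literal `natAdd 3 2 = 5`) with `P = {2, 0}` (the column literals «2 ∉ w», «0 ∉ w»,
priority `2 > 0`) — a CROSS move: three columns lose their `2`-literal, the column `{2}` loses its
`0`-literal, so the twin columns `∅ / {2}` are separated; move 2 peels coordinate `0` of the rows
(literals `0 / 3`) with `P = {0}`, `S = {1}` and the matching `(0 1)(2 3)`; the four grandchildren are
rank-one leaves. All side conditions are decided by `decide`. -/
theorem squareClaw_derivable : PPDerivable 6 6 (Fin 4) 3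
    (fun i a => if a ∈ (![∅, {0}, {1}, {0, 1}] : Fin 4 → Finset (Fin 3)) i
      then Fin.castAdd 3 a else Fin.natAdd 3 a)
    (fun j c => if c ∈ (![∅, {0}, {1}, {2}] : Fin 4 → Finset (Fin 3)) j
      then Fin.natAdd 3 c else Fin.castAdd 3 c) := by
  refine PPDerivable.pair _ _ (5 : Fin 6) (2 : Fin 6) (by decide) (fun _ => false)
    (fun _ => (2 : Fin 3)) (by decide) (by decide) ({2, 0} : Finset (Fin 6)) (∅ : Finset (Fin 6))
    (fun m => if m = 2 then 2 else if m = 0 then 1 else 0) (fun _ => false)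
    (fun j => (![2, 2, 2, 0] : Fin 4 → Fin 3) j) (by decide) (by decide) (Equiv.refl _)
    (fun _ => rfl) ?_ ?_
  · refine PPDerivable.pair _ _ (0 : Fin 6) (3 : Fin 6) (by decide)
      (fun i => (![true, false, true, false] : Fin 4 → Bool) i.1) (fun _ => (0 : Fin 2))
      (by decide) (by decide) ({0} : Finset (Fin 6)) ({1} : Finset (Fin 6)) (fun _ => 0)
      (fun j => (![false, true, false, true] : Fin 4 → Bool) j.1)
      (fun j => (![0, 1, 0, 0] : Fin 4 → Fin 2) j.1) (by decide) (by decide)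
      ((Equiv.swap (⟨0, rfl⟩ : {x : Fin 4 // false = false}) ⟨1, rfl⟩).trans
        (Equiv.swap (⟨2, rfl⟩ : {x : Fin 4 // false = false}) ⟨3, rfl⟩))
      (by decide) ?_ ?_
    · exact PPDerivable.rank_one _ _ (by decide) (by decide)
    · exact PPDerivable.rank_one _ _ (by decide) (by decide)
  · haveI : IsEmpty {x : Fin 4 // ¬ false = false} := ⟨fun x => x.2 rfl⟩
    exact PPDerivable.of_isEmpty 5 2 (by decide) 2 _ _ _

/-- Hence the TT layout matrix of square × claw (item 19152's conclusion for this layout) is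
nonsingular for some `H`. -/
theorem squareClaw_good : ∃ H : Matrix (Fin (3 + 3)) (Fin (3 + 3)) ℂ, (Matrix.of fun i j : Fin 4 =>
    (H.submatrix
      (fun a : Fin 3 => if a ∈ (![∅, {0}, {1}, {0, 1}] : Fin 4 → Finset (Fin 3)) i
        then Fin.castAdd 3 a else Fin.natAdd 3 a)
      (fun c : Fin 3 => if c ∈ (![∅, {0}, {1}, {2}] : Fin 4 → Finset (Fin 3)) j
        then Fin.natAdd 3 c else Fin.castAdd 3 c)).det).det ≠ 0 :=
  alive_of_ppDerivable squareClaw_derivable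

end Summit.ValiantsHypothesis.ValiantsHypothesis.Theorems.BarrierLever.PriorityPeeling
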